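import Summits.CriticalPhenomena.PercolationContinuityZ3.Theorems.PercNearOneGluingNoHeavyLowerTailMajorityGluingQCertSym3Sound
import HarnessLib

/-!
# The cubic orbit property of the symmetrised third moments of the cut laws (lane prim-rate, constants-miner 1, gen 36; NEXT-g37 item 1)

Support file for the closed crux `NoHeavyLowerTail` (stmt-CriticalPhenomena-4575), majority-gluing line; companion of `…MajorityGluingQCertSym3` / `…QCertSym3Sound`
(cubic analogue of `…QCertSymPerm`, whose `lawvK_comp` / `pull_permN_inv` / `permN` it reuses).  For the family `lawFam w a₀ t δ g = lawvK w a₀ (t ∘ g) δ` of cut laws of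
all relabelled enumerations: `Msym3` is invariant under relabelling the three indices (`Msym3_pull`), the canonical relabelling of a triple IS a permutation (`classPerm3`,
`unrank3_eq`), the orientation `orient3` is one of the six orderings (`orient3_cases`), hence the cubic key valuation has the ORBIT PROPERTY
**`valS3 v (2^k+1) (keyS3 k i j l) = Msym3 v i j l`** (`valS3_keyS3`) required by `SymCert3.sound3S`.  No sorries. [folklore]
-/

noncomputable section

namespace Summit.CriticalPhenomena.PercolationContinuityZ3.Theorems

open MeasureTheory Set
open Literature.Probability.LatticeModels (prodBernoulli)
open Literature.Probability.Percolation
open scoped Classical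

namespace HubOnly
namespace QCert

variable {n k : ℕ}

/-- **`Msym3` of the family of relabelled cut laws is invariant under relabelling the three indices.** -/
theorem Msym3_pull (w : Sym2 (Fin n) → unitInterval) (a₀ : Fin n) (t : Fin k → Fin n) (δ : ℝ) (σ : Equiv.Perm (Fin k)) (i j l : ℕ) :
    Msym3 (lawFam w a₀ t δ) (pull k (permN σ) i) (pull k (permN σ) j) (pull k (permN σ) l) = Msym3 (lawFam w a₀ t δ) i j l := by
  unfold Msym3 lawFam
  have h : ∀ g : Equiv.Perm (Fin k), ∀ K, lawvK w a₀ (t ∘ g) δ (pull k (permN σ) K) = lawvK w a₀ (t ∘ ⇑(g * σ⁻¹)) δ K := by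
    intro g K
    rw [Equiv.Perm.coe_mul, ← Function.comp_assoc, lawvK_comp w a₀ (t ∘ g) σ⁻¹ δ K, inv_inv]
  simp_rw [h]
  exact Equiv.sum_comp (Equiv.mulRight σ⁻¹) (fun g => lawvK w a₀ (t ∘ g) δ i * lawvK w a₀ (t ∘ g) δ j * lawvK w a₀ (t ∘ g) δ l)

/-- `unrank3` is the `ℕ`-extension of `classPerm3`. -/
theorem unrank3_eq (m i j l : ℕ) (p : ℕ) : unrank3 m i j l p = permN (classPerm3 m i j l) p := by
  unfold unrank3 permN
  by_cases hp : p < m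
  · rw [dif_pos hp, List.getD_eq_getElem _ _ (by rw [classList3_length]; exact hp)]
    rfl
  · rw [dif_neg hp, List.getD_eq_default _ _ (by rw [classList3_length]; omega)]

/-- `pull` along `unrank3` is `pull` along `classPerm3`. -/
theorem pull_unrank3 (m i j l K : ℕ) : pull m (unrank3 m i j l) K = pull m (permN (classPerm3 m i j l)) K := by
  have : unrank3 m i j l = permN (classPerm3 m i j l) := funext (unrank3_eq m i j l)
  rw [this]

/-- The canonical code of an ordered triple evaluates to its `Msym3`. -/
theorem valS3_canon3 (w : Sym2 (Fin n) → unitInterval) (a₀ : Fin n) (t : Fin k → Fin n) (δ : ℝ) (i j l : ℕ) (hj : j < 2 ^ k + 1)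
    (hl : l < 2 ^ k + 1) : valS3 (lawFam w a₀ t δ) (2 ^ k + 1) (canon3 k i j l) = Msym3 (lawFam w a₀ t δ) i j l := by
  unfold canon3 valS3
  obtain ⟨h1, h2, h3⟩ := dec_enc3 (N := 2 ^ k + 1) (a := pull k (unrank3 k i j l) i) (pull_lt_NV k (unrank3 k i j l) hj) (pull_lt_NV k (unrank3 k i j l) hl)
  rw [h1, h2, h3, pull_unrank3, pull_unrank3, pull_unrank3, Msym3_pull]

/-- The orientation is one of the six orderings. -/
theorem orient3_cases (m i j l : ℕ) :
    orient3 m i j l = (i, j, l) ∨ orient3 m i j l = (i, l, j) ∨ orient3 m i j l = (j, i, l) ∨ orient3 m i j l = (j, l, i) ∨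
      orient3 m i j l = (l, i, j) ∨ orient3 m i j l = (l, j, i) := by
  unfold orient3
  simp only []
  split_ifs <;> simp

/-- **CUBIC ORBIT PROPERTY:** for the family of relabelled cut laws, `valS3 (keyS3 k i j l) = Msym3 i j l` for all variables `i, j, l < 2^k + 1`. -/
theorem valS3_keyS3 (w : Sym2 (Fin n) → unitInterval) (a₀ : Fin n) (t : Fin k → Fin n) (δ : ℝ) (i j l : ℕ) (hi : i < 2 ^ k + 1)
    (hj : j < 2 ^ k + 1) (hl : l < 2 ^ k + 1) : valS3 (lawFam w a₀ t δ) (2 ^ k + 1) (keyS3 k i j l) = Msym3 (lawFam w a₀ t δ) i j l := by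
  have hperm := Msym3_perm (lawFam w a₀ t δ) i j l
  unfold keyS3
  simp only []
  rcases orient3_cases k i j l with h | h | h | h | h | h <;> rw [h] <;> simp only [] <;>
    first
    | rw [valS3_canon3 w a₀ t δ _ _ _ hj hl]
    | rw [valS3_canon3 w a₀ t δ _ _ _ hl hj, hperm.1]
    | rw [valS3_canon3 w a₀ t δ _ _ _ hi hl, hperm.2.1]
    | rw [valS3_canon3 w a₀ t δ _ _ _ hl hi, hperm.2.2.1]
    | rw [valS3_canon3 w a₀ t δ _ _ _ hi hj, hperm.2.2.2.1]
    | rw [valS3_canon3 w a₀ t δ _ _ _ hj hi, hperm.2.2.2.2]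

end QCert
end HubOnly

end Summit.CriticalPhenomena.PercolationContinuityZ3.Theorems

end
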